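import Literature.Topology.FourManifolds.TrisectionsSectorTwoFunction
import Literature.Topology.FourManifolds.TrisectionsTubeSaturationModel
import HarnessLib

/-!
# The second sector's function in the `2`-handles: no critical points on the tube saturation,
# exactly the critical point `c_j` (index `0`) in the chart zone

Topic `Literature/Topology/FourManifolds`; step E4c (part ii-c/d) of a Morse-theoretic
construction of Gay–Kirby's trisection for the fact seat
`provefact-Literature.Topology.FourManifolds.exists_isBalancedGKTrisection` (Gay–Kirby 2016,
Thm. 4 via §4, Lemma 14).  Everything in this file is **proved**; no new definitions.

* **Transfer through a Milnor box** (`MilnorBox.isMCriticalPt_comp_coord_iff`,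
  `MilnorBox.morseData_comp_coord`): for a model function `G` on `ℝ⁴`, `G ∘ coord_j` is
  critical at `z` iff `G` is at `coord_j z`, with the same nondegeneracy and index.
* **Tube saturation** (`HandleBoxes.not_isMCriticalPt_psiTwo_tube`): on
  `source_j ∩ {P_j < 2P_sw, A_lo < A_j < η}` (plateau of the band), `Ψ₂ = G ∘ coord_j` with
  `G = TubeSaturation.satFn T_P w c₀ ε κ η` (`psiTwoRaw_eventuallyEq_satFn`), so by
  `TrisectionsTubeSaturationModel` the second sector's function has no critical point there
  inside the sector (a critical point there would lie on the stable disc, `B_j = 0`, at height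
  `T_P(0)/2`, excluded by hypothesis).
* **Chart zone** (`HandleBoxes.psiTwoRaw_eventuallyEq_zoneFn`,
  `HandleBoxes.eq_cpt_of_isMCriticalPt_psiTwo_zone`, `HandleBoxes.morseData_psiTwo_cpt`): on
  `{A_j < a_R}` the function is `rthicken (zoneFn id w ρ R₀ c₀ ε η β₀ κ) ∘ coord_j`, so by
  `TrisectionsChartZoneCore` its only critical point there is `c_j`, nondegenerate of index `0`
  — "the `2`-handles cancel `g - k` of the `S¹ × B³`'s" in Morse form.

## References

* D. Gay, R. Kirby, *Trisecting 4-manifolds*, Geom. Topol. 20 (2016), §4, Lemma 14. [GayKirby2016]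
* J. Milnor, *Morse theory* (1963), §2–§3. [Milnor1963]
* J. Milnor, *Lectures on the h-cobordism theorem* (1965), Def. 3.1, Thm. 3.12. [MilnorHCobordism1965]
-/

open scoped Manifold ContDiff Topology
open Set Function Filter Metric

noncomputable section

universe u

namespace Literature.Topology.FourManifolds

open Flow

/-- Local notation: `𝔼 n` is the model Euclidean space `EuclideanSpace ℝ (Fin n)`. -/
local notation "𝔼 " n:arg => EuclideanSpace ℝ (Fin n)

/-! ### Transfer of Morse data through a Milnor box -/

section Transfer

variable {X : Type u} [TopologicalSpace X] [ChartedSpace (𝔼 4) X] [IsManifold (𝓡 4) ∞ X]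
  {f : X → ℝ} {ξ : Π x : X, TangentSpace (𝓡 4) x} {c : X} (D : MilnorBox (𝓡 4) f ξ c)

namespace MilnorBox

omit [IsManifold (𝓡 4) ∞ X] in
/-- The chart of a box, as a map, is its extended chart (boundaryless model). [folklore] -/
theorem extend_coe_eq : ⇑(D.chart.extend (𝓡 4)) = D.chart := by
  ext z i
  simp

omit [IsManifold (𝓡 4) ∞ X] in
/-- `coord = chart - chart c`. [folklore] -/
theorem coord_eq (z : X) : D.coord z = D.chart z - D.chart c := by
  simp [MilnorBox.coord]

omit [IsManifold (𝓡 4) ∞ X] in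
/-- On the chart target, `coord ∘ chart⁻¹` is the translation `u ↦ u - chart c`. [folklore] -/
theorem coord_symm_eq {u : 𝔼 4} (hu : u ∈ D.chart.target) : D.coord (D.chart.symm u) = u - D.chart c := by
  rw [D.coord_eq, D.chart.right_inv hu]

omit [IsManifold (𝓡 4) ∞ X] in
/-- Near `chart z`, `(G ∘ coord) ∘ chart⁻¹` is the translate `u ↦ G (u - chart c)`. [folklore] -/
theorem comp_coord_symm_eventuallyEq (G : 𝔼 4 → ℝ) {z : X} (hz : z ∈ D.chart.source) :
    (G ∘ D.coord) ∘ D.chart.symm =ᶠ[𝓝 (D.chart z)] fun u => G (u - D.chart c) := by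
  filter_upwards [D.chart.open_target.mem_nhds (D.chart.map_source hz)] with u hu
  simp only [comp_apply, D.coord_symm_eq hu]

/-- **`G ∘ coord` is critical at `z` iff `G` is critical at `coord z`** (`G` differentiable). [cite: Milnor1963, §2] -/
theorem isMCriticalPt_comp_coord_iff {G : 𝔼 4 → ℝ} {z : X} (hz : z ∈ D.chart.source)
    (hG : DifferentiableAt ℝ G (D.coord z)) :
    IsMCriticalPt (𝓡 4) (G ∘ D.coord) z ↔ fderiv ℝ G (D.coord z) = 0 := by
  have he := D.mem_maximalAtlas
  have hΘ := contMDiffOn_of_mem_maximalAtlas he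
  have hΘ' := contMDiffOn_symm_of_mem_maximalAtlas he
  have hcoord : ContMDiffAt (𝓡 4) 𝓘(ℝ, 𝔼 4) ∞ D.coord z :=
    (D.chart.contMDiffAt_extend he hz).sub contMDiffAt_const
  have hmd : MDifferentiableAt (𝓡 4) 𝓘(ℝ, ℝ) (G ∘ D.coord) z :=
    hG.hasFDerivAt.hasMFDerivAt.mdifferentiableAt.comp z (hcoord.mdifferentiableAt (by simp))
  rw [isMCriticalPt_iff_fderiv_comp_symm_eq_zero hΘ hΘ' hz hmd, (D.comp_coord_symm_eventuallyEq G hz).fderiv_eq,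
    fderiv_comp_sub, ← D.coord_eq]

omit [IsManifold (𝓡 4) ∞ X] in
/-- The chart Hessian of `G ∘ coord` in the box chart is the second derivative of `G`. [cite: Milnor1963, §2] -/
theorem hessianInChart_comp_coord_apply (G : 𝔼 4 → ℝ) {z : X} (hz : z ∈ D.chart.source) (v w : 𝔼 4) :
    hessianInChart (𝓡 4) D.chart (G ∘ D.coord) z v w = fderiv ℝ (fderiv ℝ G) (D.coord z) v w := by
  rw [RegularLevel.hessianInChart_apply_eq, ((D.comp_coord_symm_eventuallyEq G hz).fderiv).fderiv_eq,
    TubeModel.fderiv_fderiv_comp_sub_const, ← D.coord_eq]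

/-- **Morse data of `G ∘ coord` at a critical point are those of `G` at `coord z`**: the same
nondegeneracy and the same index. [cite: Milnor1963, §2–§3] -/
theorem morseData_comp_coord {G : 𝔼 4 → ℝ} {z : X} (hz : z ∈ D.chart.source)
    (hG : ContDiffAt ℝ 2 G (D.coord z)) (hcrit : IsMCriticalPt (𝓡 4) (G ∘ D.coord) z) :
    ((mhessian (𝓡 4) (G ∘ D.coord) z).Nondegenerate ↔ (mhessian (𝓡 4) G (D.coord z)).Nondegenerate) ∧
      morseIndex (𝓡 4) (G ∘ D.coord) z = morseIndex (𝓡 4) G (D.coord z) := by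
  have he := D.mem_maximalAtlas
  have he2 : D.chart ∈ IsManifold.maximalAtlas (𝓡 4) 2 X := IsManifold.maximalAtlas_subset_of_le (by norm_cast) he
  have hcoord : ContMDiffAt (𝓡 4) 𝓘(ℝ, 𝔼 4) 2 D.coord z :=
    ((D.chart.contMDiffAt_extend he hz).sub contMDiffAt_const).of_le (by norm_cast)
  have hF2 : ContMDiffAt (𝓡 4) 𝓘(ℝ, ℝ) 2 (G ∘ D.coord) z := hG.contMDiffAt.comp z hcoord
  have hB : hessianInChart (𝓡 4) D.chart (G ∘ D.coord) z = mhessian (𝓡 4) G (D.coord z) := by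
    refine LinearMap.ext fun v => LinearMap.ext fun w => ?_
    rw [D.hessianInChart_comp_coord_apply G hz, MorseBirth.mhessian_model_apply]
  constructor
  · rw [nondegenerate_mhessian_iff hF2 hcrit he2 hz, hB]
  · rw [morseIndex_eq_sigNeg_hessianInChart hF2 hcrit he2 hz, hB]; rfl

end MilnorBox

end Transfer

/-! ### The second sector's function in the handles -/

section Handles

variable {X : Type u} [TopologicalSpace X] [T2Space X] [CompactSpace X] [ChartedSpace (𝔼 4) X]
  [IsManifold (𝓡 4) ∞ X]
  {f : X → ℝ} {ξ : Π x : X, TangentSpace (𝓡 4) x} {a η : ℝ} {ι : Type} [Fintype ι]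
  (H : HandleBoxes f ξ a η ι)
  {hξ : ContMDiff (𝓡 4) (𝓡 4).tangent ∞ fun x => (⟨x, ξ x⟩ : TangentBundle (𝓡 4) X)}
  {h : IsRegularLevel (𝓡 4) f a} {φ : RegularLevel h → ℝ} {h₂ TP χlo χhi w ρ R₀ : ℝ → ℝ}
  {Spl Sbot Smin Psw c₀ ε κ aR : ℝ}

namespace HandleBoxes

omit [T2Space X] [CompactSpace X] [IsManifold (𝓡 4) ∞ X] [Fintype ι] in
/-- `s = η - A_j + B_j` is the model height of the coordinates. [folklore] -/
theorem sub_eq_sM {j : ι} {z : X} (hz : z ∈ (H.box j).chart.source) :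
    f z - a = TubeSaturation.sM η ((H.box j).coord z) := by
  rw [TubeSaturation.sM_apply, ← A_eq_nsq, ← B_eq_bsq, H.apply_eq hz]; ring

omit [T2Space X] [CompactSpace X] [IsManifold (𝓡 4) ∞ X] [Fintype ι] in
/-- `P_j` is the model first integral of the coordinates. [folklore] -/
theorem P_eq_PM (j : ι) (z : X) : H.P j z = TubeSaturation.PM ((H.box j).coord z) := by
  rw [TubeSaturation.PM_apply, ← A_eq_nsq, ← B_eq_bsq, P_def]

/-- **`T_bot = T_P(P_j)` on `source_j ∩ {P_j < 2P_sw}` in the plateau of the band.** [cite: GayKirby2016, §4, Lemma 14] -/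
theorem topHeightBot_eq_TP (hgl : IsGradientLike (𝓡 4) f ξ) (hfM : IsMorse (𝓡 4) f)
    {P₁ v₁ : ℝ} (hPsw : 2 * Psw ≤ η ^ 2) (hP₁ : 2 * P₁ < Psw)
    (hTP₂ : ∀ P, 2 * P₁ ≤ P → TP P = Spl) (hh₂v : ∀ t ≤ v₁, h₂ t = Spl)
    (hφv : ∀ j (y : RegularLevel h), y.1 ∈ (H.box j).chart.source → H.P j y.1 < 2 * Psw → φ y ≤ v₁)
    {j : ι} {z : X} (hz : z ∈ (H.box j).chart.source) (hP : H.P j z < 2 * Psw)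
    (hf₁ : a - η < f z) (hf₂ : f z < a + 2 * η) (hlo : χlo (f z - a) = 1) (hhi : χhi (f z - a) = 1) :
    H.topHeightBot hξ h φ h₂ TP χlo χhi Spl Sbot Smin Psw z = TP (H.P j z) := by
  rw [H.topHeightBot_of_eq_one hlo hhi]
  by_cases hsw : z ∈ H.swSet Psw j
  · exact H.topRaw_of_mem_swSet hsw
  · have hge : Psw ≤ H.P j z := by
      by_contra hlt; push Not at hlt; exact hsw ⟨hz, hlt⟩
    rw [H.topRaw_eq_of_mem_collar hgl hfM hPsw hTP₂ hh₂v hφv hz (by linarith) hP hf₁ hf₂, hTP₂ _ (by linarith)]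

omit [Fintype ι] in
/-- **On the band part of `source_j` with `P_j < 2P_sw` and `A_j > 0`, the point hits the
level and `φ̄ = c₀ 𝒯(coord_j)`** (projection read in the box, conservation of `𝒯`, explicit
form of `φ` near the tubes; `(κ/η)(2P_sw) < 2δ'`). [cite: GayKirby2016, §4, Lemma 14]
[cite: MilnorHCobordism1965, proof of Thm. 3.12; Thm. 4.1] -/
theorem hits_and_flowLift_eq_of_P_lt (hgl : IsGradientLike (𝓡 4) f ξ) (hfM : IsMorse (𝓡 4) f) (hε : 0 ≤ ε)
    (hκ : 0 ≤ κ) {δ' : ℝ} (hPsw : 2 * Psw ≤ η ^ 2) (hκδ : κ / η * (2 * Psw) < 2 * δ')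
    (hφ : ∀ j (y : RegularLevel h), y.1 ∈ (H.box j).chart.source →
      TubeModel.tube ε κ η ((H.box j).coord y.1) < 1 + 2 * δ' →
      φ y = c₀ * TubeModel.tube ε κ η ((H.box j).coord y.1))
    {j : ι} {z : X} (hz : z ∈ (H.box j).chart.source) (hApos : 0 < H.A j z) (hP : H.P j z < 2 * Psw)
    (hf₁ : a - η < f z) (hf₂ : f z < a + 2 * η) :
    Hits (flowθ hξ) f a z ∧ flowLift hξ h φ z = c₀ * TubeModel.tube ε κ η ((H.box j).coord z) := by
  have hη := H.eta_pos
  have hhit : Hits (flowθ hξ) f a z := by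
    rcases H.hits_or_exists_A_eq_zero (hξ := hξ) hgl hfM hf₁ hf₂ with hh | ⟨i, hbox, hA⟩
    · exact hh
    · exfalso
      by_cases hij : i = j
      · subst hij; exact hApos.ne' hA
      · exact (H.disjoint hij).le_bot ⟨hbox.1, hz⟩
  obtain ⟨hsrc, hPeq, htube⟩ := H.exists_levelProj_mem hgl hfM hPsw hz hP hf₁ hf₂ hhit
  refine ⟨hhit, ?_⟩
  rw [flowLift_of_hits φ hhit]
  set y : RegularLevel h := ⟨levelProj hξ f a z, apply_levelProj hξ hhit⟩ with hy
  have hsrc' : y.1 ∈ (H.box j).chart.source := hsrc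
  have hlt : TubeModel.tube ε κ η ((H.box j).coord y.1) < 1 + 2 * δ' := by
    show TubeModel.tube ε κ η ((H.box j).coord (levelProj hξ f a z)) < 1 + 2 * δ'
    rw [htube ε κ η]
    have h1 := H.tube_coord_le hε κ j z
    have h2 : κ / η * H.P j z ≤ κ / η * (2 * Psw) := mul_le_mul_of_nonneg_left hP.le (div_nonneg hκ hη.le)
    linarith
  rw [hφ j y hsrc' hlt]
  show c₀ * TubeModel.tube ε κ η ((H.box j).coord (levelProj hξ f a z)) = _
  rw [htube ε κ η]

/-- **`W = w(c₀ 𝒯(coord_j))` on `source_j ∩ {a_R/2 < A_j} ∩ {P_j < 2P_sw}` in the band**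
(`0 < a_R`, `ρ(A) = 1/A` on `[a_R/2, 2a_R]`, `(κ/η)(2P_sw) < 2δ'`). [cite: GayKirby2016, §4, Lemma 14] -/
theorem weight_eq_w_tube (hgl : IsGradientLike (𝓡 4) f ξ) (hfM : IsMorse (𝓡 4) f) (hε : 0 ≤ ε) (hκ : 0 ≤ κ)
    {δ' : ℝ} (hPsw : 2 * Psw ≤ η ^ 2) (hκδ : κ / η * (2 * Psw) < 2 * δ')
    (haR : 0 < aR) (hρ : ∀ A, aR / 2 ≤ A → A ≤ 2 * aR → ρ A = A⁻¹)
    (hφ : ∀ j (y : RegularLevel h), y.1 ∈ (H.box j).chart.source →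
      TubeModel.tube ε κ η ((H.box j).coord y.1) < 1 + 2 * δ' →
      φ y = c₀ * TubeModel.tube ε κ η ((H.box j).coord y.1))
    {j : ι} {z : X} (hz : z ∈ (H.box j).chart.source) (hAlo : aR / 2 < H.A j z) (hP : H.P j z < 2 * Psw)
    (hf₁ : a - η < f z) (hf₂ : f z < a + 2 * η) :
    H.weight hξ h φ w ρ c₀ ε κ aR z = w (c₀ * TubeModel.tube ε κ η ((H.box j).coord z)) := by
  have hApos : 0 < H.A j z := by linarith
  by_cases hzone : z ∈ H.zone aR j
  · rw [H.weight_of_mem_zone hzone, H.tubeHat_eq_tube (hρ _ hAlo.le (by linarith [hzone.2]))]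
  · have hall : ∀ i, z ∉ H.zone aR i := by
      intro i hi
      by_cases hij : i = j
      · subst hij; exact hzone hi
      · exact (H.disjoint hij).le_bot ⟨hi.1, hz⟩
    rw [H.weight_of_forall_not_mem hall, (H.hits_and_flowLift_eq_of_P_lt hgl hfM hε hκ hPsw hκδ hφ hz hApos hP hf₁ hf₂).2]

/-- **On the tube saturation `Ψ₂ = G ∘ coord_j` near the point**, `G = satFn T_P w c₀ ε κ η`
(`TrisectionsTubeSaturationModel`): at a point of `source_j` in the plateau of the band with
`a_R/2 < A_j`, `P_j < 2P_sw`, where `R₀ = 1` on `[a_R', ∞)`, `a_R' ≤ a_R/2`, and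
`(κ/η)(2P_sw) < 2δ'`. [cite: GayKirby2016, §4, Lemma 14] -/
theorem psiTwoRaw_eventuallyEq_satFn (hgl : IsGradientLike (𝓡 4) f ξ) (hfM : IsMorse (𝓡 4) f) (hε : 0 ≤ ε)
    (hκ : 0 ≤ κ) {δ' P₁ v₁ aR' : ℝ} (hPsw : 2 * Psw ≤ η ^ 2) (hP₁ : 2 * P₁ < Psw)
    (hTP₂ : ∀ P, 2 * P₁ ≤ P → TP P = Spl) (hh₂v : ∀ t ≤ v₁, h₂ t = Spl)
    (hφv : ∀ j (y : RegularLevel h), y.1 ∈ (H.box j).chart.source → H.P j y.1 < 2 * Psw → φ y ≤ v₁)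
    (haR : 0 < aR) (hρ : ∀ A, aR / 2 ≤ A → A ≤ 2 * aR → ρ A = A⁻¹)
    (hφ : ∀ j (y : RegularLevel h), y.1 ∈ (H.box j).chart.source →
      TubeModel.tube ε κ η ((H.box j).coord y.1) < 1 + 2 * δ' →
      φ y = c₀ * TubeModel.tube ε κ η ((H.box j).coord y.1))
    (hκδ : κ / η * (2 * Psw) < 2 * δ') (haR' : aR' ≤ aR / 2) (hR₀ : ∀ A, aR' ≤ A → R₀ A = 1)
    {j : ι} {z : X} (hz : z ∈ (H.box j).chart.source) (hAlo : aR / 2 < H.A j z)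
    (hP : H.P j z < 2 * Psw) (hf₁ : a - η < f z) (hf₂ : f z < a + 2 * η)
    (hplateau : ∀ᶠ s in 𝓝 (f z - a), χlo s = 1 ∧ χhi s = 1) :
    H.psiTwoRaw hξ h φ h₂ TP χlo χhi w ρ R₀ Spl Sbot Smin Psw c₀ ε κ aR =ᶠ[𝓝 z]
      (TubeSaturation.satFn TP w c₀ ε κ η) ∘ (H.box j).coord := by
  have hcontf : Continuous f := hfM.contMDiff.continuous
  have hband : ∀ᶠ w' in 𝓝 z, a - η < f w' ∧ f w' < a + 2 * η :=
    (hcontf.continuousAt.eventually (Ioo_mem_nhds hf₁ hf₂)).mono fun w hw => hw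
  have hs : Tendsto (fun w' => f w' - a) (𝓝 z) (𝓝 (f z - a)) := (hcontf.continuousAt.sub continuousAt_const).tendsto
  have hpl : ∀ᶠ w' in 𝓝 z, χlo (f w' - a) = 1 ∧ χhi (f w' - a) = 1 := hs.eventually hplateau
  have hsrc : ∀ᶠ w' in 𝓝 z, w' ∈ (H.box j).chart.source := (H.box j).chart.open_source.mem_nhds hz
  have hcA : ContinuousAt (H.A j) z := (H.continuousOn_A j).continuousAt ((H.box j).chart.open_source.mem_nhds hz)
  have hcP : ContinuousAt (H.P j) z := (H.continuousOn_P j).continuousAt ((H.box j).chart.open_source.mem_nhds hz)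
  filter_upwards [hsrc, hband, hpl, hcA.eventually (Ioi_mem_nhds hAlo), hcP.eventually (Iio_mem_nhds hP)]
    with w' hw' hwf hwpl hwA hwP
  have hwA' : aR / 2 < H.A j w' := hwA
  have hwP' : H.P j w' < 2 * Psw := hwP
  simp only [comp_apply, TubeSaturation.satFn_apply, psiTwoRaw]
  rw [H.topHeightBot_eq_TP hgl hfM hPsw hP₁ hTP₂ hh₂v hφv hw' hwP' hwf.1 hwf.2 hwpl.1 hwpl.2,
    H.weight_eq_w_tube hgl hfM hε hκ hPsw hκδ haR hρ hφ hw' hwA' hwP' hwf.1 hwf.2,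
    H.radial_of_mem_source hw', hR₀ _ (by linarith), ← H.sub_eq_sM hw', ← H.P_eq_PM]
  ring

/-- **No critical point of `ψ₂` on the tube saturation inside the sector**: near a point as in
`psiTwoRaw_eventuallyEq_satFn`, with `0 < s`, `0 < T_P(P_j) - s`, `w(c₀𝒯) > 0`, `w' < 0` there,
`T_P' ≤ 0`, `c₀, ε, κ/η > 0`, `C ≠ 0`, and `2s < T_P(0)` if `B_j = 0`. [cite: GayKirby2016, §4, Lemma 14] -/
theorem not_isMCriticalPt_psiTwo_tube {C : ℝ} (hTP : Differentiable ℝ TP) (hw : Differentiable ℝ w)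
    {j : ι} {z : X} (hz : z ∈ (H.box j).chart.source)
    (hev : H.psiTwoRaw hξ h φ h₂ TP χlo χhi w ρ R₀ Spl Sbot Smin Psw c₀ ε κ aR =ᶠ[𝓝 z]
      (TubeSaturation.satFn TP w c₀ ε κ η) ∘ (H.box j).coord)
    (hC : C ≠ 0) (hApos : 0 < H.A j z) (hs : 0 < f z - a) (hV : 0 < TP (H.P j z) - (f z - a))
    (hW : 0 < w (c₀ * TubeModel.tube ε κ η ((H.box j).coord z)))
    (hW' : deriv w (c₀ * TubeModel.tube ε κ η ((H.box j).coord z)) < 0)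
    (hTP' : deriv TP (H.P j z) ≤ 0) (hc₀ : 0 < c₀) (hε : 0 < ε) (hκ : 0 < κ / η)
    (hlow : H.B j z = 0 → 2 * (f z - a) < TP 0) :
    ¬ IsMCriticalPt (𝓡 4) (H.psiTwo hξ h φ h₂ TP χlo χhi w ρ R₀ Spl Sbot Smin Psw c₀ ε κ aR C) z := by
  set G : 𝔼 4 → ℝ := fun u => 1 - C * TubeSaturation.satFn TP w c₀ ε κ η u with hG
  have hev' : H.psiTwo hξ h φ h₂ TP χlo χhi w ρ R₀ Spl Sbot Smin Psw c₀ ε κ aR C =ᶠ[𝓝 z] fun z' =>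
      (G ∘ (H.box j).coord) z' + 0 := by
    filter_upwards [hev] with z' hz'
    simp only [psiTwo, hz', comp_apply, hG, add_zero]
  rw [isMCriticalPt_congr_of_eventuallyEq_add_const (I := 𝓡 4) hev']
  have hu : TubeModel.nsq (RadialThickening.proj ((H.box j).coord z)) ≠ 0 := by
    rw [← A_eq_nsq]; exact hApos.ne'
  have hGd : DifferentiableAt ℝ (TubeSaturation.satFn TP w c₀ ε κ η) ((H.box j).coord z) := by
    have hsM := TubeSaturation.differentiableAt_sM η ((H.box j).coord z)
    have hT : DifferentiableAt ℝ (TubeModel.tube ε κ η) ((H.box j).coord z) :=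
      (TubeModel.contDiffAt_tube (m := 1) ε κ η hu).differentiableAt one_ne_zero
    exact ((hsM.mul (((hTP _).comp _ (TubeSaturation.differentiableAt_PM _)).sub hsM)).mul
      ((hw _).comp _ (hT.const_mul c₀)))
  have hGd' : DifferentiableAt ℝ G ((H.box j).coord z) := (differentiableAt_const _).sub ((differentiableAt_const _).mul hGd)
  rw [(H.box j).isMCriticalPt_comp_coord_iff hz hGd']
  intro h0
  have h1 : fderiv ℝ G ((H.box j).coord z) = -C • fderiv ℝ (TubeSaturation.satFn TP w c₀ ε κ η) ((H.box j).coord z) := by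
    rw [hG, fderiv_const_sub, fderiv_const_mul hGd, neg_smul]
  rw [h1, smul_eq_zero] at h0
  rcases h0 with h' | h'
  · exact hC (neg_eq_zero.1 h')
  · obtain ⟨hB, -, h2s⟩ := TubeSaturation.eq_of_fderiv_satFn_eq_zero hTP hw hu (by rwa [← H.sub_eq_sM hz])
      (by rwa [← H.sub_eq_sM hz, ← H.P_eq_PM]) hW hW' (by rwa [← H.P_eq_PM]) hc₀ hε hκ h'
    rw [← B_eq_bsq] at hB
    rw [← H.sub_eq_sM hz] at h2s
    exact absurd h2s (hlow hB).ne

/-! ### The chart zone -/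

/-- The radial thickening of the chart-zone function, unfolded on `ℝ⁴`. [folklore] -/
theorem rthicken_zoneFn_apply (U w ρ R : ℝ → ℝ) (c ε η β₀ κ : ℝ) (u : 𝔼 4) :
    RadialThickening.rthicken (ChartZone.zoneFn U w ρ R c ε η β₀ κ) u =
      U (η - TubeModel.nsq (RadialThickening.proj u) + RadialThickening.bsq u) *
        ((β₀ + TubeModel.nsq (RadialThickening.proj u)) * (β₀ - RadialThickening.bsq u) / β₀) *
        w (c * (ChartZone.gmod ε ρ (RadialThickening.proj u) +
          κ / η * TubeModel.nsq (RadialThickening.proj u) * RadialThickening.bsq u)) *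
        R (TubeModel.nsq (RadialThickening.proj u)) := by
  rw [RadialThickening.rthicken_apply, ChartZone.zoneFn_apply, TubeModel.planarProj_toModel,
    RadialThickening.toModel_apply_two]

/-- **On the chart zone `Ψ₂ = rthicken (zoneFn id w ρ R₀ c₀ ε η β₀ κ) ∘ coord_j` near the
point** (plateau of the band; `T_P(P) = η + β₀ - P/β₀` for `P ≤ P₁`, `2η·a_R ≤ P₁ < P_sw/… `,
`β₀ ≠ 0`, `a_R ≤ η`). [cite: GayKirby2016, §4, Lemma 14] -/
theorem psiTwoRaw_eventuallyEq_zoneFn (hfM : IsMorse (𝓡 4) f) {β₀ P₁ : ℝ} (hβ₀ : β₀ ≠ 0)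
    (hTP₁ : ∀ P, P ≤ P₁ → TP P = η + β₀ - P / β₀) (haRP : 2 * η * aR ≤ P₁) (hP₁ : P₁ < Psw) (haRη : aR ≤ η)
    {j : ι} {z : X} (hz : z ∈ H.zone aR j) (hf₂ : f z < a + 2 * η)
    (hplateau : ∀ᶠ s in 𝓝 (f z - a), χlo s = 1 ∧ χhi s = 1) :
    H.psiTwoRaw hξ h φ h₂ TP χlo χhi w ρ R₀ Spl Sbot Smin Psw c₀ ε κ aR =ᶠ[𝓝 z]
      (RadialThickening.rthicken (ChartZone.zoneFn (fun x => x) w ρ R₀ c₀ ε η β₀ κ)) ∘ (H.box j).coord := by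
  have hcontf : Continuous f := hfM.contMDiff.continuous
  have hband : ∀ᶠ w' in 𝓝 z, f w' < a + 2 * η := hcontf.continuousAt.eventually (Iio_mem_nhds hf₂)
  have hs : Tendsto (fun w' => f w' - a) (𝓝 z) (𝓝 (f z - a)) := (hcontf.continuousAt.sub continuousAt_const).tendsto
  have hpl : ∀ᶠ w' in 𝓝 z, χlo (f w' - a) = 1 ∧ χhi (f w' - a) = 1 := hs.eventually hplateau
  filter_upwards [(H.isOpen_zone aR j).mem_nhds hz, hband, hpl] with w' hw' hwf hwpl
  have hA := hw'.2
  have hA0 := H.A_nonneg j w'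
  have haR : 0 ≤ aR := by linarith
  have hB : H.B j w' < 2 * η := by have := H.apply_eq hw'.1; linarith
  have hPle : H.P j w' ≤ P₁ := by
    rw [P_def]
    have : H.A j w' * H.B j w' ≤ aR * (2 * η) := mul_le_mul hA.le hB.le (H.B_nonneg j w') haR
    linarith
  have hsw : w' ∈ H.swSet Psw j := ⟨hw'.1, by linarith⟩
  have hT : H.topHeightBot hξ h φ h₂ TP χlo χhi Spl Sbot Smin Psw w' = η + β₀ - H.P j w' / β₀ := by
    rw [H.topHeightBot_of_eq_one hwpl.1 hwpl.2, H.topRaw_of_mem_swSet hsw, hTP₁ _ hPle]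
  simp only [comp_apply, rthicken_zoneFn_apply, psiTwoRaw]
  rw [hT, H.weight_of_mem_zone hw', H.radial_of_mem_source hw'.1, tubeHat, TubeModel.tubeHat_apply,
    P_def, A_eq_nsq, B_eq_bsq, H.apply_eq hw'.1, A_eq_nsq, B_eq_bsq]
  field_simp
  ring

/-- `1 - C · rthicken Φ = rthicken (1 - C Φ)`. [folklore] -/
theorem one_sub_mul_rthicken (C : ℝ) (Φ : 𝔼 3 → ℝ) :
    (fun u => 1 - C * RadialThickening.rthicken Φ u) = RadialThickening.rthicken fun q => 1 - C * Φ q := by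
  funext u; rfl

/-- **A critical point of `ψ₂` in the chart zone is the critical point `c_j`**, given the
hypotheses of `ChartZone.eq_zero_of_isMCriticalPt_rthicken_zoneFn` at `coord_j z` (`C ≠ 0`).
[cite: GayKirby2016, §4, Lemma 14] -/
theorem eq_cpt_of_isMCriticalPt_psiTwo_zone {C β₀ : ℝ} (hw : ContDiff ℝ 2 w) (hρ : ContDiff ℝ 2 ρ)
    (hR : ContDiff ℝ 2 R₀) (hβ₀ : β₀ ≠ 0) (hC : C ≠ 0) {j : ι} {z : X} (hz : z ∈ (H.box j).chart.source)
    (hev : H.psiTwoRaw hξ h φ h₂ TP χlo χhi w ρ R₀ Spl Sbot Smin Psw c₀ ε κ aR =ᶠ[𝓝 z]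
      (RadialThickening.rthicken (ChartZone.zoneFn (fun x => x) w ρ R₀ c₀ ε η β₀ κ)) ∘ (H.box j).coord)
    (hb : fderiv ℝ (ChartZone.zoneFn (fun x => x) w ρ R₀ c₀ ε η β₀ κ) (RadialThickening.toModel ((H.box j).coord z))
      PlanarThickening.ez ≠ 0)
    (hApos : 0 < (η - TubeModel.nsq (RadialThickening.proj ((H.box j).coord z))) *
      (β₀ + TubeModel.nsq (RadialThickening.proj ((H.box j).coord z))) *
      R₀ (TubeModel.nsq (RadialThickening.proj ((H.box j).coord z))))
    (hρ0 : 0 ≤ ρ (TubeModel.nsq (RadialThickening.proj ((H.box j).coord z))))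
    (hρ' : deriv ρ (TubeModel.nsq (RadialThickening.proj ((H.box j).coord z))) ≤ 0)
    (hw' : deriv w (c₀ * ChartZone.gmod ε ρ (RadialThickening.proj ((H.box j).coord z))) ≤ 0)
    (hcε : 0 ≤ c₀ * ε)
    (hD : ChartZone.DesignIneq (fun a' => (η - a') * (β₀ + a') * R₀ a') w ρ c₀ ε
      (TubeModel.nsq (RadialThickening.proj ((H.box j).coord z)))
      (c₀ * ChartZone.gmod ε ρ (RadialThickening.proj ((H.box j).coord z))))
    (hcrit : IsMCriticalPt (𝓡 4) (H.psiTwo hξ h φ h₂ TP χlo χhi w ρ R₀ Spl Sbot Smin Psw c₀ ε κ aR C) z) :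
    z = H.cpt j := by
  set Φ := ChartZone.zoneFn (fun x => x) w ρ R₀ c₀ ε η β₀ κ with hΦ
  have hev' : H.psiTwo hξ h φ h₂ TP χlo χhi w ρ R₀ Spl Sbot Smin Psw c₀ ε κ aR C =ᶠ[𝓝 z] fun z' =>
      ((fun u => 1 - C * RadialThickening.rthicken Φ u) ∘ (H.box j).coord) z' + 0 := by
    filter_upwards [hev] with z' hz'
    simp only [psiTwo, hz', comp_apply, add_zero]
  rw [isMCriticalPt_congr_of_eventuallyEq_add_const (I := 𝓡 4) hev'] at hcrit
  have hΦc : ContDiff ℝ 2 Φ := ChartZone.contDiff_zoneFn (contDiff_id) hw hρ hR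
  have hrd : Differentiable ℝ (RadialThickening.rthicken Φ) := by
    have : RadialThickening.rthicken Φ = Φ ∘ RadialThickening.toModel := rfl
    rw [this]
    exact (hΦc.differentiable (by norm_num)).comp ((RadialThickening.contDiff_toModel (n := 1)).differentiable one_ne_zero)
  have hGd : DifferentiableAt ℝ (fun u => 1 - C * RadialThickening.rthicken Φ u) ((H.box j).coord z) :=
    (differentiableAt_const _).sub ((differentiableAt_const _).mul (hrd _))
  rw [(H.box j).isMCriticalPt_comp_coord_iff hz hGd, fderiv_const_sub, fderiv_const_mul (hrd _), neg_eq_zero,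
    smul_eq_zero] at hcrit
  have h0 : fderiv ℝ (RadialThickening.rthicken Φ) ((H.box j).coord z) = 0 := hcrit.resolve_left hC
  have hcritΦ : IsMCriticalPt (𝓡 4) (RadialThickening.rthicken Φ) ((H.box j).coord z) :=
    (MorseBirth.isMCriticalPt_iff_fderiv _ _).2 h0
  have hcoord : (H.box j).coord z = 0 :=
    ChartZone.eq_zero_of_isMCriticalPt_rthicken_zoneFn contDiff_id hw hρ hR hβ₀ hb (by simpa using hApos) hρ0 hρ' hw' hcε
      (by simpa using hD) hcritΦ
  -- `coord z = 0` forces `z = c_j`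
  have h1 : (H.box j).chart z = (H.box j).chart (H.cpt j) := by
    have := (H.box j).coord_eq z
    rw [hcoord] at this
    exact (sub_eq_zero.1 this.symm)
  exact (H.box j).chart.injOn hz (H.box j).mem_source h1

/-- **At `c_j` the second sector's function has a nondegenerate critical point of index `0`**,
given the hypotheses of `ChartZone.morseData_rthicken_one_sub_zoneFn_zero` (`C > 0`).
[cite: GayKirby2016, §4, Lemma 14] [cite: Milnor1963, §2–§3] -/
theorem morseData_psiTwo_cpt {C β₀ : ℝ} (hw : ContDiff ℝ 2 w) (hρ : ContDiff ℝ 2 ρ)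
    (hR : ContDiff ℝ 2 R₀) (hβ₀ : β₀ ≠ 0) (hC : 0 < C) {j : ι}
    (hev : H.psiTwoRaw hξ h φ h₂ TP χlo χhi w ρ R₀ Spl Sbot Smin Psw c₀ ε κ aR =ᶠ[𝓝 (H.cpt j)]
      (RadialThickening.rthicken (ChartZone.zoneFn (fun x => x) w ρ R₀ c₀ ε η β₀ κ)) ∘ (H.box j).coord)
    (hb : fderiv ℝ (ChartZone.zoneFn (fun x => x) w ρ R₀ c₀ ε η β₀ κ) 0 PlanarThickening.ez < 0)
    (hApos : 0 < η * β₀ * R₀ 0) (hρ0 : 0 ≤ ρ 0) (hw' : deriv w c₀ ≤ 0) (hcε : 0 ≤ c₀ * ε)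
    (hD : ChartZone.DesignIneq (fun a' => (η - a') * (β₀ + a') * R₀ a') w ρ c₀ ε 0 c₀) :
    IsMCriticalPt (𝓡 4) (H.psiTwo hξ h φ h₂ TP χlo χhi w ρ R₀ Spl Sbot Smin Psw c₀ ε κ aR C) (H.cpt j) ∧
      (mhessian (𝓡 4) (H.psiTwo hξ h φ h₂ TP χlo χhi w ρ R₀ Spl Sbot Smin Psw c₀ ε κ aR C) (H.cpt j)).Nondegenerate ∧
      morseIndex (𝓡 4) (H.psiTwo hξ h φ h₂ TP χlo χhi w ρ R₀ Spl Sbot Smin Psw c₀ ε κ aR C) (H.cpt j) = 0 := by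
  set Φ := ChartZone.zoneFn (fun x => x) w ρ R₀ c₀ ε η β₀ κ with hΦ
  set G : 𝔼 4 → ℝ := RadialThickening.rthicken fun q => 1 - C * Φ q with hG
  have hz : H.cpt j ∈ (H.box j).chart.source := (H.box j).mem_source
  have hc0 : (H.box j).coord (H.cpt j) = 0 := (H.box j).coord_self
  have hev' : H.psiTwo hξ h φ h₂ TP χlo χhi w ρ R₀ Spl Sbot Smin Psw c₀ ε κ aR C =ᶠ[𝓝 (H.cpt j)] fun z' =>
      (G ∘ (H.box j).coord) z' + 0 := by
    filter_upwards [hev] with z' hz'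
    simp only [psiTwo, hz', comp_apply, add_zero, hG, RadialThickening.rthicken_apply]
  obtain ⟨hcritG, hndG, hidxG⟩ := ChartZone.morseData_rthicken_one_sub_zoneFn_zero (U := fun x => x)
    contDiff_id hw hρ hR hβ₀ hC hb (by simpa using hApos) hρ0 hw' hcε (by simpa using hD)
  have hΦc : ContDiff ℝ 2 Φ := ChartZone.contDiff_zoneFn contDiff_id hw hρ hR
  have hGc : ContDiff ℝ 2 G := by
    have : G = (fun q => 1 - C * Φ q) ∘ RadialThickening.toModel := rfl
    rw [this]
    exact (contDiff_const.sub (contDiff_const.mul hΦc)).comp (RadialThickening.contDiff_toModel.of_le (by norm_cast))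
  have hcrit : IsMCriticalPt (𝓡 4) (G ∘ (H.box j).coord) (H.cpt j) := by
    rw [(H.box j).isMCriticalPt_comp_coord_iff hz (hGc.differentiable (by norm_num) _), hc0]
    exact (MorseBirth.isMCriticalPt_iff_fderiv _ _).1 hcritG
  obtain ⟨hnd, hidx⟩ := (H.box j).morseData_comp_coord hz (by rw [hc0]; exact hGc.contDiffAt) hcrit
  rw [hc0] at hnd hidx
  refine ⟨?_, ?_, ?_⟩
  · exact (isMCriticalPt_congr_of_eventuallyEq_add_const (I := 𝓡 4) hev').2 hcrit
  · rw [mhessian_congr_of_eventuallyEq_add_const (I := 𝓡 4) hev', hnd]; exact hndG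
  · unfold morseIndex
    rw [mhessian_congr_of_eventuallyEq_add_const (I := 𝓡 4) hev']
    unfold morseIndex at hidx hidxG
    rw [hidx, hidxG]


/-! ### Variants with refined hypotheses (thresholds read off the point) -/

/-- **On the tube saturation `Ψ₂ = G ∘ coord_j` near the point** — variant of
`psiTwoRaw_eventuallyEq_satFn` in which the radial correction is only required to be `1` on
`[a_R', ∞)` for some `a_R' < A_j(z)` (instead of `a_R' ≤ a_R/2`), so that `R₀` may differ from `1`
on part of `[a_R/2, a_R)`. [cite: GayKirby2016, §4, Lemma 14] -/
theorem psiTwoRaw_eventuallyEq_satFn' (hgl : IsGradientLike (𝓡 4) f ξ) (hfM : IsMorse (𝓡 4) f) (hε : 0 ≤ ε)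
    (hκ : 0 ≤ κ) {δ' P₁ v₁ aR' : ℝ} (hPsw : 2 * Psw ≤ η ^ 2) (hP₁ : 2 * P₁ < Psw)
    (hTP₂ : ∀ P, 2 * P₁ ≤ P → TP P = Spl) (hh₂v : ∀ t ≤ v₁, h₂ t = Spl)
    (hφv : ∀ j (y : RegularLevel h), y.1 ∈ (H.box j).chart.source → H.P j y.1 < 2 * Psw → φ y ≤ v₁)
    (haR : 0 < aR) (hρ : ∀ A, aR / 2 ≤ A → A ≤ 2 * aR → ρ A = A⁻¹)
    (hφ : ∀ j (y : RegularLevel h), y.1 ∈ (H.box j).chart.source →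
      TubeModel.tube ε κ η ((H.box j).coord y.1) < 1 + 2 * δ' →
      φ y = c₀ * TubeModel.tube ε κ η ((H.box j).coord y.1))
    (hκδ : κ / η * (2 * Psw) < 2 * δ') (hR₀ : ∀ A, aR' ≤ A → R₀ A = 1)
    {j : ι} {z : X} (hz : z ∈ (H.box j).chart.source) (hAlo : aR / 2 < H.A j z) (haR'z : aR' < H.A j z)
    (hP : H.P j z < 2 * Psw) (hf₁ : a - η < f z) (hf₂ : f z < a + 2 * η)
    (hplateau : ∀ᶠ s in 𝓝 (f z - a), χlo s = 1 ∧ χhi s = 1) :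
    H.psiTwoRaw hξ h φ h₂ TP χlo χhi w ρ R₀ Spl Sbot Smin Psw c₀ ε κ aR =ᶠ[𝓝 z]
      (TubeSaturation.satFn TP w c₀ ε κ η) ∘ (H.box j).coord := by
  have hcontf : Continuous f := hfM.contMDiff.continuous
  have hband : ∀ᶠ w' in 𝓝 z, a - η < f w' ∧ f w' < a + 2 * η :=
    (hcontf.continuousAt.eventually (Ioo_mem_nhds hf₁ hf₂)).mono fun w hw => hw
  have hs : Tendsto (fun w' => f w' - a) (𝓝 z) (𝓝 (f z - a)) := (hcontf.continuousAt.sub continuousAt_const).tendsto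
  have hpl : ∀ᶠ w' in 𝓝 z, χlo (f w' - a) = 1 ∧ χhi (f w' - a) = 1 := hs.eventually hplateau
  have hsrc : ∀ᶠ w' in 𝓝 z, w' ∈ (H.box j).chart.source := (H.box j).chart.open_source.mem_nhds hz
  have hcA : ContinuousAt (H.A j) z := (H.continuousOn_A j).continuousAt ((H.box j).chart.open_source.mem_nhds hz)
  have hcP : ContinuousAt (H.P j) z := (H.continuousOn_P j).continuousAt ((H.box j).chart.open_source.mem_nhds hz)
  filter_upwards [hsrc, hband, hpl, hcA.eventually (Ioi_mem_nhds hAlo), hcA.eventually (Ioi_mem_nhds haR'z),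
    hcP.eventually (Iio_mem_nhds hP)] with w' hw' hwf hwpl hwA hwR hwP
  have hwA' : aR / 2 < H.A j w' := hwA
  have hwR' : aR' < H.A j w' := hwR
  have hwP' : H.P j w' < 2 * Psw := hwP
  simp only [comp_apply, TubeSaturation.satFn_apply, psiTwoRaw]
  rw [H.topHeightBot_eq_TP hgl hfM hPsw hP₁ hTP₂ hh₂v hφv hw' hwP' hwf.1 hwf.2 hwpl.1 hwpl.2,
    H.weight_eq_w_tube hgl hfM hε hκ hPsw hκδ haR hρ hφ hw' hwA' hwP' hwf.1 hwf.2,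
    H.radial_of_mem_source hw', hR₀ _ hwR'.le, ← H.sub_eq_sM hw', ← H.P_eq_PM]
  ring

/-- **On the chart zone `Ψ₂ = Φ(x, |y|²) ∘ coord_j` near the point** — variant of
`psiTwoRaw_eventuallyEq_zoneFn` with the refined co-core bound: for a zone point with
`f - a < S_top'` the product `P_j = A_j B_j` is below `a_R (S_top' - η + a_R)`, so it suffices that
this (rather than `2η a_R`) is `≤ P₁`. [cite: GayKirby2016, §4, Lemma 14] -/
theorem psiTwoRaw_eventuallyEq_zoneFn' (hfM : IsMorse (𝓡 4) f) {β₀ P₁ Stop' : ℝ} (hβ₀ : β₀ ≠ 0)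
    (hTP₁ : ∀ P, P ≤ P₁ → TP P = η + β₀ - P / β₀) (haRP : aR * (Stop' - η + aR) ≤ P₁) (hP₁ : P₁ < Psw) (haR0 : 0 ≤ aR)
    {j : ι} {z : X} (hz : z ∈ H.zone aR j) (hf₂ : f z - a < Stop')
    (hplateau : ∀ᶠ s in 𝓝 (f z - a), χlo s = 1 ∧ χhi s = 1) :
    H.psiTwoRaw hξ h φ h₂ TP χlo χhi w ρ R₀ Spl Sbot Smin Psw c₀ ε κ aR =ᶠ[𝓝 z]
      (RadialThickening.rthicken (ChartZone.zoneFn (fun x => x) w ρ R₀ c₀ ε η β₀ κ)) ∘ (H.box j).coord := by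
  have hcontf : Continuous f := hfM.contMDiff.continuous
  have hband : ∀ᶠ w' in 𝓝 z, f w' - a < Stop' :=
    (hcontf.continuousAt.sub continuousAt_const).eventually (Iio_mem_nhds hf₂)
  have hs : Tendsto (fun w' => f w' - a) (𝓝 z) (𝓝 (f z - a)) := (hcontf.continuousAt.sub continuousAt_const).tendsto
  have hpl : ∀ᶠ w' in 𝓝 z, χlo (f w' - a) = 1 ∧ χhi (f w' - a) = 1 := hs.eventually hplateau
  filter_upwards [(H.isOpen_zone aR j).mem_nhds hz, hband, hpl] with w' hw' hwf hwpl
  have hA := hw'.2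
  have hB : H.B j w' ≤ Stop' - η + aR := by have := H.apply_eq hw'.1; linarith
  have hPle : H.P j w' ≤ P₁ := by
    rw [P_def]
    have : H.A j w' * H.B j w' ≤ aR * (Stop' - η + aR) := mul_le_mul hA.le hB (H.B_nonneg j w') haR0
    linarith
  have hsw : w' ∈ H.swSet Psw j := ⟨hw'.1, by linarith⟩
  have hT : H.topHeightBot hξ h φ h₂ TP χlo χhi Spl Sbot Smin Psw w' = η + β₀ - H.P j w' / β₀ := by
    rw [H.topHeightBot_of_eq_one hwpl.1 hwpl.2, H.topRaw_of_mem_swSet hsw, hTP₁ _ hPle]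
  simp only [comp_apply, rthicken_zoneFn_apply, psiTwoRaw]
  rw [hT, H.weight_of_mem_zone hw', H.radial_of_mem_source hw'.1, tubeHat, TubeModel.tubeHat_apply,
    P_def, A_eq_nsq, B_eq_bsq, H.apply_eq hw'.1, A_eq_nsq, B_eq_bsq]
  field_simp
  ring

end HandleBoxes

end Handles

end Literature.Topology.FourManifolds

end
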